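import Summits.ResolutionOfSingularities.ResolutionOfSingularities.Theorems.MarkedTransferCampaignW46WWalkHasseDoor
import Summits.ResolutionOfSingularities.ResolutionOfSingularities.Theorems.WeightedInvariantWeightedConstructionPlexComapResidueField
import Summits.ResolutionOfSingularities.ResolutionOfSingularities.Theorems.WildConesCampaignW46RsopAdapted
import Literature.AlgebraicGeometry.Resolution.DiffIdealFlatBaseChange
import Literature.AlgebraicGeometry.Hironaka2017.Lib.TaylorFrameExistence
import HarnessLib

/-!
# [OURS · L1 W4.6 rung (iii-2)] THE PORTABLE DOOR: the approximate exit at an isolated `b`-fold closed point is a statement about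
# Hasse derivatives in Cohen coordinates, hence survives EVERY extension of the coefficient field

Cell `res-hironaka`, LADDER-RESOLUTION rung L (D-0089), slot W4.6 rung (iii); seat res-L1-s46-pv-5 (gen 7). Host route MarkedTransfer,
`--supports stmt-ResolutionOfSingularities-16155 --as helper`; kind proof (def-free). Plan `HOME/L/res-L1-s46-pv-5/NOTES.md` (gen 7, file F1b);
algebra in `…WWalkHasseDoor.lean` (F1a).

WHAT. At a closed point `ξ` of a stage with `Sing(E) ⊆ Z_cl` over a PERFECT ground field `K`, embedding dimension `3`, `b = E.b > 0`:
* `residueField_finite_of_isClosed` — `κ(ξ)` is finite over `K` (Stacks 01TB; the tree's `finite_preimage_fromSpecResidueField`);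
* `exists_pow_le_hasseSpan_of_ringEquiv` — for ANY ring isomorphism `e : 𝒪̂_ξ ≅ L⟦t, y, z⟧` onto a power series ring over a perfect field `L`
  of characteristic `p` there is `N = N(ξ)` with `𝔪^N ⊆ (Δ_α g : |α| ≤ b − 1)` for the generator `g` of `J_ξ · L⟦t,y,z⟧`. Chain:
  `𝔪_ξ^N ⊆ Diff^{≤ b−1}_K(J_ξ)` (tree `exists_pow_maximalIdeal_le_diffIdeal_of_isolated`), `Diff` commutes with completion (tree
  `diffIdeal_map_adicCompletion_le`), `K`-linear Cohen coordinates `𝒪̂_ξ ≅_K κ⟦X⟧` (tree `S03DiffARNE.exists_algEquiv_adicCompletion_mvPowerSeries`,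
  `κ = κ(ξ̂)` finite separable over `K`), `Diff_K ⊆ Diff_κ =` Hasse span and transport to the GIVEN coordinates along `e ∘ (Cohen)⁻¹` (F1a);
* `exists_forall_map_not_mem_span_pair_pow_sup` — base change along any `ι : L → Ω` (F1a): **for all `u, v ∈ 𝔪_Ω`,
  `(f₀ ⊗ Ω) ∉ (u, v)^b + 𝔪_Ω^N`** (`J_ξ = (f₀)`).

HONEST FRAMING. OURS; nothing here is a statement of H. Hironaka's manuscript [Hironaka2017] and nothing of it is used; no FACT-LIST premise.
AI-written; AI review is weaker than expert review. No `sorry`; axioms standard. References: O. Villamayor U., Rev. Mat. Iberoam. 24 (2008)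
§4.1 [VillamayorU2008ReesDiff]; H. Matsumura, *Commutative Ring Theory* (1986) §28, Thm. 29.7 [Matsumura1987]; EGA IV₄ Thm. 16.11.2 [EGAIV4];
Stacks Project Tags 00DV, 01TB [StacksProject].
-/

noncomputable section

set_option linter.dupNamespace false -- mandated namespace of this single-conjunct summit

open IsLocalRing MvPowerSeries

namespace Summit.ResolutionOfSingularities.ResolutionOfSingularities.Theorems

namespace CampaignW46

namespace WWalk

open Literature.AlgebraicGeometry.Resolution
open Literature.RingTheory.MvPowerSeries (hasseDeriv)
open CampaignW46.FormalChart (ringEquiv_mem_maximalIdeal ringEquiv_mem_maximalIdeal_pow)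

/-! ## §2 The portable door at a closed point of a stage with `Sing(E) ⊆ Z_cl` over a perfect ground field -/

section Scheme

open CategoryTheory AlgebraicGeometry TopologicalSpace
open Literature.AlgebraicGeometry.Hironaka2017.S02Preliminaries
open Literature.AlgebraicGeometry.Hironaka2017.Datum

variable {p : ℕ} [hp : Fact p.Prime] {K : Type} [Field K] [CharP K p]

omit hp [CharP K p] in
/-- **The residue field at a closed point is finite over the ground field** (scheme locally of finite type over a field, closed points of
Jacobson schemes, Stacks 01TB), for the `K`-structure `stalkAlgebra` of the stalk. [cite: StacksProject, Tag 01TB] -/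
theorem residueField_finite_of_isClosed {Y : Scheme.{0}} (f : Y ⟶ Spec (.of K)) [LocallyOfFiniteType f] (y : Y)
    (hy : IsClosed ({y} : Set Y)) :
    letI := stalkAlgebra (f.appTop.hom.comp (Scheme.ΓSpecIso (.of K)).inv.hom) y
    Module.Finite K (ResidueField (Y.presheaf.stalk y)) := by
  letI algP : Algebra K (Y.presheaf.stalk y) := stalkAlgebra (f.appTop.hom.comp (Scheme.ΓSpecIso (.of K)).inv.hom) y
  have hpre : Spec.preimage (Y.fromSpecResidueField y ≫ f) =
      (Scheme.ΓSpecIso (.of K)).inv ≫ f.appTop ≫ Y.presheaf.germ ⊤ y trivial ≫ Y.residue y := by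
    rw [← specMap_residue_germ_appTop f y, Spec.preimage_map]
  have halg : ((Scheme.ΓSpecIso (.of K)).inv ≫ f.appTop ≫ Y.presheaf.germ ⊤ y trivial ≫ Y.residue y).hom =
      algebraMap K (ResidueField (Y.presheaf.stalk y)) :=
    RingHom.ext fun _ => rfl
  have hfin : (algebraMap K (ResidueField (Y.presheaf.stalk y))).Finite := by
    have h := Literature.AlgebraicGeometry.Motives.finite_preimage_fromSpecResidueField f hy
    rw [hpre, halg] at h
    exact h
  exact (RingHom.finite_algebraMap).mp hfin

/-- **THE PORTABLE DOOR, Hasse-span form.** `K` perfect, `(A, E)` a stage with `Sing(E) ⊆ Z_cl`, `b = E.b > 0`, `ξ` a CLOSED point with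
`𝒪_{Z,ξ}` of embedding dimension `3`, and `e : 𝒪̂_{Z,ξ} ≅ L⟦t, y, z⟧` ANY ring isomorphism onto a power series ring over a perfect field `L`
of characteristic `p`. Then there is `N = N(ξ)` with `𝔪^N ⊆ (Δ_α g : |α| ≤ b − 1)` for every generator `g` of `J_ξ · L⟦t,y,z⟧`.
Chain: `𝔪_ξ^N ⊆ Diff^{≤ b−1}_K(J_ξ)` (isolated point, tree `exists_pow_maximalIdeal_le_diffIdeal_of_isolated`); `Diff` passes to the completion
(`diffIdeal_map_adicCompletion_le`); `K`-linear Cohen coordinates `𝒪̂_ξ ≅_K κ⟦X⟧` (`κ = κ(ξ)` finite separable over `K`); `Diff_K ⊆ Diff_κ =`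
Hasse span (§1); transport along `e ∘ (Cohen)⁻¹` (§1c). [cite: VillamayorU2008ReesDiff, §4.1] [cite: Matsumura1987, Thm. 29.7 and §28]
[cite: EGAIV4, Thm. 16.11.2] -/
theorem exists_pow_le_hasseSpan_of_ringEquiv [PerfectField K] (A : AmbientDatum p K) (E : IdealExponent A.Z)
    (hcl : E.sing ⊆ Literature.AlgebraicGeometry.Hironaka2017.S02Preliminaries.closedPoints A.Z) (hb : 0 < E.b) {ξ : A.Z}
    (hξ : IsClosed ({ξ} : Set A.Z)) (h3 : (maximalIdeal (A.Z.presheaf.stalk ξ)).spanFinrank = 3)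
    {L : Type} [Field L] [CharP L p] [PerfectField L]
    (e : AdicCompletion (maximalIdeal (A.Z.presheaf.stalk ξ)) (A.Z.presheaf.stalk ξ) ≃+* MvPowerSeries (Option (Fin 2)) L) :
    ∃ N : ℕ, ∀ g : MvPowerSeries (Option (Fin 2)) L,
      (stalkIdeal E.J ξ).map ((e : _ →+* MvPowerSeries (Option (Fin 2)) L).comp
          (algebraMap (A.Z.presheaf.stalk ξ) (AdicCompletion (maximalIdeal (A.Z.presheaf.stalk ξ)) (A.Z.presheaf.stalk ξ)))) =
        Ideal.span {g} →
      maximalIdeal (MvPowerSeries (Option (Fin 2)) L) ^ N ≤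
        Ideal.span ((fun α : Option (Fin 2) →₀ ℕ => hasseDeriv α g) '' {α | α.degree ≤ E.b - 1}) := by
  classical
  haveI := A.smooth
  haveI : IsNoetherian A.Z := A.isNoetherian_ambient
  haveI : IsIntegral A.Z := A.isIntegral_ambient
  haveI : IsRegularLocalRing (A.Z.presheaf.stalk ξ) := ambient_isRegular A ξ
  set R := A.Z.presheaf.stalk ξ with hR
  letI algR : Algebra K R := stalkAlgebra (A.hom.appTop.hom.comp (Scheme.ΓSpecIso (.of K)).inv.hom) ξ
  set Rhat := AdicCompletion (maximalIdeal R) R with hRhat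
  set ι := algebraMap R Rhat with hι
  -- (1) the door in `Diff` form at the stalk
  have hisol : ∀ ζ : A.Z, ζ ⤳ ξ → ζ ≠ ξ → ¬ (((E.b - 1 + 1 : ℕ) : ℕ∞) ≤ idealOrder E.J ζ) := fun ζ hζ hne => by
    rw [Nat.sub_add_cancel hb]
    exact not_le_idealOrder_of_specializes_of_sing_subset_closedPoints E hcl hζ hne
  obtain ⟨N, hN⟩ := exists_pow_maximalIdeal_le_diffIdeal_of_isolated A.hom E.J hisol
  -- (2) `K`-linear Cohen coordinates (the residue field is finite separable over `K`)
  haveI : Module.Finite K (ResidueField R) := residueField_finite_of_isClosed A.hom ξ hξ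
  haveI : Algebra.IsAlgebraic K (ResidueField R) := Algebra.IsAlgebraic.of_finite K _
  haveI : Algebra.IsSeparable K (ResidueField R) := Algebra.IsAlgebraic.isSeparable_of_perfectField
  obtain ⟨c, hc, -⟩ := CampaignW46.FormalChart.exists_rsop_adapted e
  set x : Fin 3 → R := c ∘ finSuccEquiv 2 with hx
  have hxspan : Ideal.span (Set.range x) = maximalIdeal R := by
    rw [hx, Set.range_comp, (finSuccEquiv 2).surjective.range_eq, Set.image_univ, hc]
  have hn : ringKrullDim R = (3 : ℕ) := by
    have h := IsRegularLocalRing.spanFinrank_maximalIdeal (R := R)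
    rw [h3] at h
    exact_mod_cast h.symm
  obtain ⟨eK, -, -, -⟩ := Literature.AlgebraicGeometry.Hironaka2017.S03DiffARNE.exists_algEquiv_adicCompletion_mvPowerSeries K R x hxspan hn
  -- the coefficient field `κ = κ(R̂)` is algebraic over `K`
  let ρ₀ : ResidueField R →ₐ[K] ResidueField Rhat :=
    { toRingHom := ResidueField.map ι
      commutes' := Literature.AlgebraicGeometry.Hironaka2017.S03DiffARNE.residueField_map_algebraMap_adicCompletion_commutes K R }
  let ρ : ResidueField R ≃ₐ[K] ResidueField Rhat := AlgEquiv.ofBijective ρ₀ (AdicCompletion.residueField_map_bijective R)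
  haveI : Module.Finite K (ResidueField Rhat) := Module.Finite.equiv ρ.toLinearEquiv
  haveI : Algebra.IsAlgebraic K (ResidueField Rhat) := Algebra.IsAlgebraic.of_finite K _
  -- (3) `𝔪̂^N ⊆ Diff^{≤ b−1}_K (J_ξ R̂)`
  have hNhat : maximalIdeal Rhat ^ N ≤ diffIdeal K (E.b - 1) ((stalkIdeal E.J ξ).map ι) := by
    rw [AdicCompletion.maximalIdeal_eq_map, ← Ideal.map_pow]
    exact (Ideal.map_mono hN).trans (diffIdeal_map_adicCompletion_le K (maximalIdeal R) (E.b - 1) (stalkIdeal E.J ξ))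
  refine ⟨N, fun g hg => ?_⟩
  -- (4) read `J_ξ R̂` in the `K`-linear coordinates: generator `θ g`, `θ := eK ∘ e⁻¹`
  set θ : MvPowerSeries (Option (Fin 2)) L ≃+* MvPowerSeries (Fin 3) (ResidueField Rhat) := e.symm.trans eK.toRingEquiv with hθ
  have hθe : ∀ r : Rhat, θ (e r) = eK r := fun r => by
    rw [hθ, RingEquiv.trans_apply, RingEquiv.symm_apply_apply]; rfl
  have hJK : ((stalkIdeal E.J ξ).map ι).map (eK : Rhat →+* MvPowerSeries (Fin 3) (ResidueField Rhat)) = Ideal.span {θ g} := by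
    have hcomp : (eK : Rhat →+* MvPowerSeries (Fin 3) (ResidueField Rhat)).comp ι =
        (θ : _ →+* _).comp ((e : Rhat →+* MvPowerSeries (Option (Fin 2)) L).comp ι) := by
      refine RingHom.ext fun r => ?_
      change eK (ι r) = θ (e (ι r))
      rw [hθe]
    rw [Ideal.map_map, hcomp, ← Ideal.map_map, hg, Ideal.map_span, Set.image_singleton]
    rfl
  have hK : maximalIdeal (MvPowerSeries (Fin 3) (ResidueField Rhat)) ^ N ≤
      Ideal.span ((fun α : Fin 3 →₀ ℕ => hasseDeriv α (θ g)) '' {α | α.degree ≤ E.b - 1}) := by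
    have h4 : maximalIdeal (MvPowerSeries (Fin 3) (ResidueField Rhat)) ^ N ≤
        (maximalIdeal Rhat ^ N).map (eK : Rhat →+* MvPowerSeries (Fin 3) (ResidueField Rhat)) := by
      intro y hy
      have hy' : eK.symm y ∈ maximalIdeal Rhat ^ N := ringEquiv_mem_maximalIdeal_pow eK.toRingEquiv.symm hy
      have := Ideal.mem_map_of_mem (eK : Rhat →+* MvPowerSeries (Fin 3) (ResidueField Rhat)) hy'
      rwa [show (eK : Rhat →+* MvPowerSeries (Fin 3) (ResidueField Rhat)) (eK.symm y) = y from eK.apply_symm_apply y] at this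
    refine h4.trans ((Ideal.map_mono hNhat).trans ?_)
    have h5 : (diffIdeal K (E.b - 1) ((stalkIdeal E.J ξ).map ι)).map (eK : Rhat →+* MvPowerSeries (Fin 3) (ResidueField Rhat)) =
        diffIdeal K (E.b - 1) (Ideal.span {θ g}) := by
      rw [← hJK]; exact diffIdeal_map_algEquiv eK (E.b - 1) _
    rw [h5]
    exact (diffIdeal_le_diffIdeal_of_isAlgebraic (𝕂 := K) (L := ResidueField Rhat) (E.b - 1) _).trans
      (diffIdeal_span_singleton_le_hasseSpan (E.b - 1) (θ g))
  -- (5) transport back along `θ⁻¹`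
  have h6 := maximalIdeal_pow_le_hasseSpan_of_ringEquiv p θ.symm hK
  rwa [RingEquiv.symm_apply_apply] at h6

/-- **THE PORTABLE DOOR, two-generator form over any bigger field.** Under the hypotheses of `exists_pow_le_hasseSpan_of_ringEquiv`, with
`J_ξ = (f₀)` principal, and for any field map `ι : L → Ω`: there is `N` with `(f₀ read in Ω⟦t,y,z⟧) ∉ (u, v)^b + 𝔪_Ω^N` for ALL `u, v ∈ 𝔪_Ω` —
no curve germ with coefficients in ANY extension of the Cohen coefficient field is approximately `b`-fold for `J_ξ`.
[cite: VillamayorU2008ReesDiff, §4.1] [cite: StacksProject, Tag 00DV] -/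
theorem exists_forall_map_not_mem_span_pair_pow_sup [PerfectField K] (A : AmbientDatum p K) (E : IdealExponent A.Z)
    (hcl : E.sing ⊆ Literature.AlgebraicGeometry.Hironaka2017.S02Preliminaries.closedPoints A.Z) (hb : 0 < E.b) {ξ : A.Z}
    (hξ : IsClosed ({ξ} : Set A.Z)) (h3 : (maximalIdeal (A.Z.presheaf.stalk ξ)).spanFinrank = 3)
    {L : Type} [Field L] [CharP L p] [PerfectField L]
    (e : AdicCompletion (maximalIdeal (A.Z.presheaf.stalk ξ)) (A.Z.presheaf.stalk ξ) ≃+* MvPowerSeries (Option (Fin 2)) L)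
    {f₀ : A.Z.presheaf.stalk ξ} (hJ : stalkIdeal E.J ξ = Ideal.span {f₀}) {Ω : Type} [Field Ω] (ιΩ : L →+* Ω) :
    ∃ N : ℕ, ∀ u v : MvPowerSeries (Option (Fin 2)) Ω, u ∈ maximalIdeal _ → v ∈ maximalIdeal _ →
      MvPowerSeries.map ιΩ (e (algebraMap (A.Z.presheaf.stalk ξ) _ f₀)) ∉
        Ideal.span {u, v} ^ E.b ⊔ maximalIdeal (MvPowerSeries (Option (Fin 2)) Ω) ^ N := by
  classical
  obtain ⟨N, hN⟩ := exists_pow_le_hasseSpan_of_ringEquiv A E hcl hb hξ h3 e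
  have hg : (stalkIdeal E.J ξ).map ((e : _ →+* MvPowerSeries (Option (Fin 2)) L).comp
      (algebraMap (A.Z.presheaf.stalk ξ) (AdicCompletion (maximalIdeal (A.Z.presheaf.stalk ξ)) (A.Z.presheaf.stalk ξ)))) =
      Ideal.span {e (algebraMap (A.Z.presheaf.stalk ξ) _ f₀)} := by
    rw [hJ, Ideal.map_span, Set.image_singleton]; rfl
  have hΩ := maximalIdeal_pow_le_hasseSpan_map ιΩ (hN _ hg)
  exact ⟨N + E.b, fun u v hu hv hmem =>
    not_span_le_span_pair_pow_sup_of_hasseSpan hb hΩ hu hv ((Ideal.span_singleton_le_iff_mem _).mpr hmem)⟩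

end Scheme

end WWalk

end CampaignW46

end Summit.ResolutionOfSingularities.ResolutionOfSingularities.Theorems

end
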